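import Summits.BirchSwinnertonDyer.BirchSwinnertonDyer.Theorems.Rank2Observatory2DescVCover
import Summits.BirchSwinnertonDyer.BirchSwinnertonDyer.Theorems.Rank2Observatory2DescClTDescent
import HarnessLib

/-!
# BirchSwinnertonDyer — rank ≥ 2 observatory: the `V`-cover of the class-group-general 2-descent (KERNEL-2DESC-CL, N3/N4)

HONEST FRAMING: per-curve certified theorems and census instruments; no claim on BSD in rank ≥ 2.

Generic file N3 (+ N4) of the class-group-general cubic-field `2`-descent (design
`b2b-bsdr2-cert-1/KERNEL-2DESC-CL.md`): the PID hypothesis of `Rank2Observatory2DescVCover` is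
removed. Setting: `E : y² = F(x) = x³ + Ax² + Bx + C` over `ℚ`, `F` irreducible, `θ ∈ 𝓞 K` a root,
`K = ℚ(θ)` cubic of ANY class number; `M ∈ 𝓞 K ∖ 0` (in practice a rational integer) such that
(a) every prime containing `F′(θ)` contains `M` and (b) the classes of the ideals containing `M`
generate `Cl(𝓞 K)`; `W : Fin n → 𝓞 K` a family of `T`-units (`T` = primes containing `M`) spanning the
`T`-units of `K` modulo squares (`Rank2Observatory2DescClTUnitsModSq`). Then
* `exists_isSquare_descent_value_cl`: for every rational point, `(x − θ) · ∏_{j ∈ U} W j` is a square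
  of `K` for some `U` (parity theorem at the primes `∌ M` + the descent `K(S,2) ⊆ U_T·K²` of
  `Rank2Observatory2DescClTDescent` + spanning);
* `sqClass_mem_coverSet_cl`, `mordellWeilRank_le_of_coverSet_cl`: the cover / rank-bound theorems of
  the PID instrument with these hypotheses (same `coverSet`, empty unit family, same Boolean sieves);
* N4 `valRow_sound`: soundness of a **valuation-parity row** of the sieve — at a prime `v ∌ F′(θ)`
  the number of `j ∈ U` with `ord_v(W j)` odd is even (true Selmer condition at `v`).
[cite: Cassels1991LecturesEllipticCurves, §15] [cite: SilvermanAEC2009, Prop. VIII.1.6 (proof), Ch. X §1]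

## References
* J. W. S. Cassels, *Lectures on Elliptic Curves*, LMS Student Texts 24 (1991), §15.
  [Cassels1991LecturesEllipticCurves]
* J. H. Silverman, *The Arithmetic of Elliptic Curves*, 2nd ed., GTM 106 (2009), VIII.1.6, X.1.
  [SilvermanAEC2009]
-/

-- single-conjunct summit: `Summit.BirchSwinnertonDyer.BirchSwinnertonDyer.…` repeats the name by design
set_option linter.dupNamespace false

noncomputable section

open scoped Classical NumberField nonZeroDivisors

open Literature.NumberTheory.EllipticCurves Literature.NumberTheory.NumberFields
open WeierstrassCurve WeierstrassCurve.Affine WeierstrassCurve.Affine.Point Polynomial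

namespace Summit.BirchSwinnertonDyer.BirchSwinnertonDyer.Rank2Observatory.TwoDescCl

open IsDedekindDomain IsDedekindDomain.HeightOneSpectrum NumberField Module TwoDescCubic

variable {K : Type*} [Field K] [NumberField K]

/-! ## The descent value -/

/-- **The `V`-cover of the cubic-field descent, any class number.** `θ ∈ 𝓞 K` a root of
`F = X³ + AX² + BX + C`, not rational; `M ≠ 0` with every prime `∋ F′(θ)` containing `M` and the
classes of the ideals `∋ M` generating the class group; `W` integral `T`-units spanning the `T`-units
modulo squares. Then for every rational point `(x, y)` of `y² = F(x)`, `(x − θ) · ∏_{j ∈ U} W j` is a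
square of `K` for some `U`. [cite: Cassels1991LecturesEllipticCurves, §15]
[cite: SilvermanAEC2009, Prop. VIII.1.6 (proof)] -/
theorem exists_isSquare_descent_value_cl {A B C : ℤ} {θ : 𝓞 K}
    (hF : θ ^ 3 + A * θ ^ 2 + B * θ + C = 0)
    (hθQ : ∀ q : ℚ, algebraMap ℚ K q ≠ algebraMap (𝓞 K) K θ)
    {M : 𝓞 K} (hM : M ≠ 0)
    (hgen : Subgroup.closure {c : ClassGroup (𝓞 K) | ∃ (J : Ideal (𝓞 K))
      (hJ : J ∈ (Ideal (𝓞 K))⁰), M ∈ J ∧ ClassGroup.mk0 ⟨J, hJ⟩ = c} = ⊤)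
    (hDM : ∀ v : HeightOneSpectrum (𝓞 K),
      (3 : 𝓞 K) * θ ^ 2 + 2 * (A : 𝓞 K) * θ + (B : 𝓞 K) ∈ v.asIdeal → M ∈ v.asIdeal)
    {n : ℕ} {W : Fin n → 𝓞 K}
    (hW : ∀ u : K, u ≠ 0 →
      (∀ v : HeightOneSpectrum (𝓞 K), M ∉ v.asIdeal → v.valuation K u = 1) →
      ∃ U : Finset (Fin n), IsSquare (u * ∏ j ∈ U, algebraMap (𝓞 K) K (W j)))
    {x y : ℚ} (hE : y ^ 2 = x ^ 3 + A * x ^ 2 + B * x + C) :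
    ∃ U : Finset (Fin n), IsSquare ((algebraMap ℚ K x - algebraMap (𝓞 K) K θ) *
      ∏ j ∈ U, algebraMap (𝓞 K) K (W j)) := by
  have hx : algebraMap ℚ K x ≠ algebraMap (𝓞 K) K θ := hθQ x
  have hξ : algebraMap ℚ K x - algebraMap (𝓞 K) K θ ≠ 0 := sub_ne_zero.mpr hx
  -- parity of `ord_v (x − θ)` at the primes `v ∌ M` (they do not contain `F′(θ)`)
  have hval : ∀ v : HeightOneSpectrum (𝓞 K), M ∉ v.asIdeal →
      (2 : ℤ) ∣ WithZero.log (v.valuation K (algebraMap ℚ K x - algebraMap (𝓞 K) K θ)) := by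
    intro v hv
    have hE' : (algebraMap ℚ K y) ^ 2 = (algebraMap ℚ K x) ^ 3 +
        algebraMap (𝓞 K) K A * (algebraMap ℚ K x) ^ 2 + algebraMap (𝓞 K) K B * algebraMap ℚ K x +
          algebraMap (𝓞 K) K C := by
      have h := congrArg (algebraMap ℚ K) hE
      simp only [map_pow, map_add, map_mul, map_intCast] at h
      simp only [map_intCast]
      exact h
    exact two_dvd_log_valuation_x_sub_theta v hF (fun hD => hv (hDM v hD)) hx hE'
  -- the descent: `(x − θ) · z² = t`, `t` an integral `T`-unit
  obtain ⟨z, t, hz, ht0, htM, hzt⟩ := exists_tsupp_eq_mul_sq_of_closure_eq_top M hM hgen hξ hval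
  have htK : ((t : 𝓞 K) : K) ≠ 0 := RingOfIntegers.coe_ne_zero_iff.mpr ht0
  have htval : ∀ v : HeightOneSpectrum (𝓞 K), M ∉ v.asIdeal → v.valuation K (t : K) = 1 := by
    intro v hv
    rw [RingOfIntegers.coe_eq_algebraMap, valuation_eq_one_iff_notMem]
    exact fun ht => hv (htM v ht)
  -- absorb `t` by the explicit family
  obtain ⟨U, r, hr⟩ := hW (t : K) htK htval
  refine ⟨U, r / z, ?_⟩
  rw [div_mul_div_comm, ← hr, ← hzt]
  field_simp

/-! ## The cover and the rank bound -/

variable {n : ℕ}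

/-- **Cover theorem** (any class number): if `adm` accepts every pair `(T, U)` (`T ⊆ Fin 0`: the
unit slot of the PID instrument is empty, units sit in `W`) for which `(x − θ)·∏_{U} W` is a square
at some rational point, then the class `(x − θ)·K×²` of every rational point lies in `coverSet`.
[cite: Cassels1991LecturesEllipticCurves, §15] -/
theorem sqClass_mem_coverSet_cl {A B C : ℤ} {θ : 𝓞 K}
    (hF : θ ^ 3 + A * θ ^ 2 + B * θ + C = 0)
    (hθQ : ∀ q : ℚ, algebraMap ℚ K q ≠ algebraMap (𝓞 K) K θ)
    {M : 𝓞 K} (hM : M ≠ 0)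
    (hgen : Subgroup.closure {c : ClassGroup (𝓞 K) | ∃ (J : Ideal (𝓞 K))
      (hJ : J ∈ (Ideal (𝓞 K))⁰), M ∈ J ∧ ClassGroup.mk0 ⟨J, hJ⟩ = c} = ⊤)
    (hDM : ∀ v : HeightOneSpectrum (𝓞 K),
      (3 : 𝓞 K) * θ ^ 2 + 2 * (A : 𝓞 K) * θ + (B : 𝓞 K) ∈ v.asIdeal → M ∈ v.asIdeal)
    {W : Fin n → 𝓞 K} (hW0 : ∀ j, W j ≠ 0)
    (hW : ∀ u : K, u ≠ 0 →
      (∀ v : HeightOneSpectrum (𝓞 K), M ∉ v.asIdeal → v.valuation K u = 1) →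
      ∃ U : Finset (Fin n), IsSquare (u * ∏ j ∈ U, algebraMap (𝓞 K) K (W j)))
    {Wu : Fin 0 → (𝓞 K)ˣ} {adm : Finset (Fin 0) → Finset (Fin n) → Bool}
    (hadm : ∀ x y : ℚ, y ^ 2 = x ^ 3 + A * x ^ 2 + B * x + C →
      ∀ (T : Finset (Fin 0)) (U : Finset (Fin n)),
        IsSquare ((algebraMap ℚ K x - algebraMap (𝓞 K) K θ) *
          (∏ i ∈ T, algebraMap (𝓞 K) K (Wu i)) * ∏ j ∈ U, algebraMap (𝓞 K) K (W j)) →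
        adm T U = true)
    {x y : ℚ} (hE : y ^ 2 = x ^ 3 + A * x ^ 2 + B * x + C) :
    sqClass (algebraMap ℚ K x - algebraMap (𝓞 K) K θ) ∈ coverSet Wu W adm := by
  obtain ⟨U, hsq⟩ := exists_isSquare_descent_value_cl hF hθQ hM hgen hDM hW hE
  have hT0 : (∅ : Finset (Fin 0)) = Finset.univ := by
    ext i; exact Fin.elim0 i
  have hsq' : IsSquare ((algebraMap ℚ K x - algebraMap (𝓞 K) K θ) *
      (∏ i ∈ (∅ : Finset (Fin 0)), algebraMap (𝓞 K) K (Wu i)) *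
        ∏ j ∈ U, algebraMap (𝓞 K) K (W j)) := by
    simpa only [Finset.prod_empty, mul_one] using hsq
  refine Finset.mem_image.mpr ⟨(∅, U), Finset.mem_filter.mpr
    ⟨Finset.mem_product.mpr ⟨Finset.mem_univ _, Finset.mem_univ _⟩, hadm x y hE ∅ U hsq'⟩, ?_⟩
  set ξ := algebraMap ℚ K x - algebraMap (𝓞 K) K θ with hξdef
  set w := (∏ i ∈ (∅ : Finset (Fin 0)), algebraMap (𝓞 K) K (Wu i)) *
    ∏ j ∈ U, algebraMap (𝓞 K) K (W j) with hwdef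
  have hξ : ξ ≠ 0 := sub_ne_zero.mpr (hθQ x)
  have hw : w ≠ 0 := by
    refine mul_ne_zero (Finset.prod_ne_zero_iff.mpr fun i _ => ?_)
      (Finset.prod_ne_zero_iff.mpr fun j _ => ?_)
    · exact RingOfIntegers.coe_ne_zero_iff.mpr (Units.ne_zero (Wu i))
    · exact RingOfIntegers.coe_ne_zero_iff.mpr (hW0 j)
  obtain ⟨r, hr⟩ := hsq'
  have hprod : sqClass ξ * sqClass w = 1 := by
    rw [← sqClass_mul hξ hw, hwdef, ← mul_assoc, hr, sqClass_mul_self]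
  show sqClass w = sqClass ξ
  calc sqClass w = 1 * sqClass w := (SqUnits.one_mul _).symm
    _ = sqClass ξ * sqClass ξ * sqClass w := by rw [SqUnits.mul_self]
    _ = sqClass ξ * (sqClass ξ * sqClass w) := by rw [mul_assoc]
    _ = sqClass ξ := by rw [hprod, SqUnits.mul_one]

/-- **Rank bound of the class-group-general cubic-field 2-descent from certificates.**
`E : y² = x³ + Ax² + Bx + C` over `ℚ`, `F` irreducible, `θ ∈ 𝓞 K` a root, `K` cubic (any class
number); `M ≠ 0` with (a) every prime `∋ F′(θ)` containing `M`, (b) the classes of the ideals `∋ M`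
generating `Cl(𝓞 K)`; `W` non-zero integral `T`-units spanning the `T`-units modulo squares; `adm` a
Boolean sieve accepting every pair realised by a rational point, the empty pair admissible. Then
`rank E(ℚ) ≤ s'` whenever the number of admissible pairs is `≤ 2^{s'}`.
[cite: Cassels1991LecturesEllipticCurves, §15] [cite: SilvermanAEC2009, Ch. X §1] -/
theorem mordellWeilRank_le_of_coverSet_cl {A B C : ℤ}
    (E : WeierstrassCurve ℚ) [E.IsElliptic] (ha₁ : E.a₁ = 0) (ha₂ : E.a₂ = A) (ha₃ : E.a₃ = 0)
    (ha₄ : E.a₄ = B) (ha₆ : E.a₆ = C) (hirr : Irreducible (MonicCubic.polyQ A B C)) {θ : 𝓞 K}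
    (hθ : aeval (algebraMap (𝓞 K) K θ) (MonicCubic.poly A B C) = 0) (h3 : finrank ℚ K = 3)
    {M : 𝓞 K} (hM : M ≠ 0)
    (hgen : Subgroup.closure {c : ClassGroup (𝓞 K) | ∃ (J : Ideal (𝓞 K))
      (hJ : J ∈ (Ideal (𝓞 K))⁰), M ∈ J ∧ ClassGroup.mk0 ⟨J, hJ⟩ = c} = ⊤)
    (hDM : ∀ v : HeightOneSpectrum (𝓞 K),
      (3 : 𝓞 K) * θ ^ 2 + 2 * (A : 𝓞 K) * θ + (B : 𝓞 K) ∈ v.asIdeal → M ∈ v.asIdeal)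
    {W : Fin n → 𝓞 K} (hW0 : ∀ j, W j ≠ 0)
    (hW : ∀ u : K, u ≠ 0 →
      (∀ v : HeightOneSpectrum (𝓞 K), M ∉ v.asIdeal → v.valuation K u = 1) →
      ∃ U : Finset (Fin n), IsSquare (u * ∏ j ∈ U, algebraMap (𝓞 K) K (W j)))
    {Wu : Fin 0 → (𝓞 K)ˣ} {adm : Finset (Fin 0) → Finset (Fin n) → Bool} (h0 : adm ∅ ∅ = true)
    (hadm : ∀ x y : ℚ, y ^ 2 = x ^ 3 + A * x ^ 2 + B * x + C →
      ∀ (T : Finset (Fin 0)) (U : Finset (Fin n)),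
        IsSquare ((algebraMap ℚ K x - algebraMap (𝓞 K) K θ) *
          (∏ i ∈ T, algebraMap (𝓞 K) K (Wu i)) * ∏ j ∈ U, algebraMap (𝓞 K) K (W j)) →
        adm T U = true)
    {s' : ℕ} (hcard : ((Finset.univ ×ˢ Finset.univ).filter
      (fun p : Finset (Fin 0) × Finset (Fin n) => adm p.1 p.2 = true)).card ≤ 2 ^ s') :
    E.mordellWeilRank ≤ s' := by
  have hrootK := MonicCubic.theta_rel hθ
  have hF : θ ^ 3 + A * θ ^ 2 + B * θ + C = 0 := by
    apply RingOfIntegers.coe_injective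
    simpa only [map_add, map_mul, map_pow, map_intCast, _root_.map_zero] using hrootK
  have hroot : (algebraMap (𝓞 K) K θ) ^ 3 + algebraMap ℚ K E.a₂ * (algebraMap (𝓞 K) K θ) ^ 2 +
      algebraMap ℚ K E.a₄ * algebraMap (𝓞 K) K θ + algebraMap ℚ K E.a₆ = 0 := by
    rw [ha₂, ha₄, ha₆]
    simpa only [map_intCast] using hrootK
  have hlin := powIndep_algebraMap hirr hθ h3
  have hspan := exists_coords hirr hθ h3
  have hθQ : ∀ q : ℚ, algebraMap ℚ K q ≠ algebraMap (𝓞 K) K θ := ne_of_powIndep hlin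
  refine mordellWeilRank_le_of_sqClass_cover E (algebraMap ℚ K) ha₁ ha₃ hroot hlin hspan
    (coverSet Wu W adm) (one_mem_coverSet Wu W h0) ?_ ((card_coverSet_le Wu W adm).trans hcard)
  intro x y hxy
  have hE : y ^ 2 = x ^ 3 + A * x ^ 2 + B * x + C := by
    have h := hxy.left
    rw [WeierstrassCurve.Affine.equation_iff] at h
    have e₁ : E.toAffine.a₁ = 0 := ha₁
    have e₂ : E.toAffine.a₂ = A := ha₂
    have e₃ : E.toAffine.a₃ = 0 := ha₃
    have e₄ : E.toAffine.a₄ = B := ha₄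
    have e₆ : E.toAffine.a₆ = C := ha₆
    rw [e₁, e₂, e₃, e₄, e₆] at h
    linear_combination h
  exact sqClass_mem_coverSet_cl hF hθQ hM hgen hDM hW0 hW hadm hE

/-! ## N4: valuation-parity rows of the sieve -/

/-- `log v(∏ f) = ∑ log v(f)` for non-zero factors. [folklore] -/
theorem log_valuation_prod (v : HeightOneSpectrum (𝓞 K)) {ι : Type*} (s : Finset ι) (f : ι → K)
    (hf : ∀ i ∈ s, f i ≠ 0) :
    WithZero.log (v.valuation K (∏ i ∈ s, f i)) = ∑ i ∈ s, WithZero.log (v.valuation K (f i)) := by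
  induction s using Finset.induction_on with
  | empty => simp
  | insert a s ha ih =>
    rw [Finset.prod_insert ha, Finset.sum_insert ha, map_mul,
      WithZero.log_mul ((Valuation.ne_zero_iff _).mpr (hf a (Finset.mem_insert_self a s)))
        ((Valuation.ne_zero_iff _).mpr (Finset.prod_ne_zero_iff.mpr fun i hi =>
          hf i (Finset.mem_insert_of_mem hi))),
      ih fun i hi => hf i (Finset.mem_insert_of_mem hi)]

/-- `∑_{U} a` is even iff the number of odd terms is even. [folklore] -/
theorem even_sum_iff_even_card_filter_odd {ι : Type*} (U : Finset ι) (a : ι → ℤ) :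
    Even (∑ j ∈ U, a j) ↔ Even (U.filter fun j => Odd (a j)).card := by
  induction U using Finset.induction_on with
  | empty => simp
  | insert b U hb ih =>
    rw [Finset.sum_insert hb, Finset.filter_insert, Int.even_add, ih]
    by_cases hodd : Odd (a b)
    · rw [if_pos hodd, Finset.card_insert_of_notMem (fun h => hb (Finset.mem_filter.mp h).1),
        Nat.even_add_one]
      have : ¬ Even (a b) := Int.not_even_iff_odd.mpr hodd
      tauto
    · rw [if_neg hodd]
      have : Even (a b) := Int.not_odd_iff_even.mp hodd
      tauto

/-- **Soundness of a valuation-parity row** (true Selmer condition at a prime `v ∌ F′(θ)`): if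
`(x − θ) · ∏_{T} Wu · ∏_{U} W` is a square in `K` at a rational point, then the number of `j ∈ U` with
`ord_v(W j)` odd — recorded by the certified bit-vector `r` — is even, because `ord_v(x − θ)` is
even (parity theorem) and units have valuation `0`. [cite: Cassels1991LecturesEllipticCurves, §15] -/
theorem valRow_sound {A B C : ℤ} {θ : 𝓞 K} (hF : θ ^ 3 + A * θ ^ 2 + B * θ + C = 0)
    (hθQ : ∀ q : ℚ, algebraMap ℚ K q ≠ algebraMap (𝓞 K) K θ)
    (v : HeightOneSpectrum (𝓞 K))
    (hderiv : (3 : 𝓞 K) * θ ^ 2 + 2 * (A : 𝓞 K) * θ + (B : 𝓞 K) ∉ v.asIdeal)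
    {W : Fin n → 𝓞 K} (hW0 : ∀ j, W j ≠ 0) {r : Fin n → Bool}
    (hr : ∀ j, r j = true ↔ ¬ (2 : ℤ) ∣ WithZero.log (v.valuation K (algebraMap (𝓞 K) K (W j))))
    {m : ℕ} {Wu : Fin m → (𝓞 K)ˣ}
    (x y : ℚ) (hE : y ^ 2 = x ^ 3 + A * x ^ 2 + B * x + C) (T : Finset (Fin m))
    (U : Finset (Fin n))
    (hsq : IsSquare ((algebraMap ℚ K x - algebraMap (𝓞 K) K θ) *
      (∏ i ∈ T, algebraMap (𝓞 K) K (Wu i)) * ∏ j ∈ U, algebraMap (𝓞 K) K (W j))) :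
    decide (Even (U.filter fun j => r j = true).card) = true := by
  rw [decide_eq_true_eq]
  have hx : algebraMap ℚ K x ≠ algebraMap (𝓞 K) K θ := hθQ x
  have hξ : algebraMap ℚ K x - algebraMap (𝓞 K) K θ ≠ 0 := sub_ne_zero.mpr hx
  have hE' : (algebraMap ℚ K y) ^ 2 = (algebraMap ℚ K x) ^ 3 +
      algebraMap (𝓞 K) K A * (algebraMap ℚ K x) ^ 2 + algebraMap (𝓞 K) K B * algebraMap ℚ K x +
        algebraMap (𝓞 K) K C := by
    have h := congrArg (algebraMap ℚ K) hE
    simp only [map_pow, map_add, map_mul, map_intCast] at h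
    simp only [map_intCast]
    exact h
  have hpar := two_dvd_log_valuation_x_sub_theta v hF hderiv hx hE'
  -- valuations of the factors
  have hWu : ∀ i, WithZero.log (v.valuation K (algebraMap (𝓞 K) K (Wu i : 𝓞 K))) = 0 := by
    intro i
    have h1 : v.valuation K (algebraMap (𝓞 K) K (Wu i : 𝓞 K)) = 1 :=
      (valuation_eq_one_iff_notMem (v := v) (K := K)).mpr
        (fun h => v.isPrime.ne_top (Ideal.eq_top_of_isUnit_mem _ h (Wu i).isUnit))
    rw [h1, WithZero.log_one]
  have hne : ∀ w : K, w ≠ 0 → v.valuation K w ≠ 0 := fun w hw => (Valuation.ne_zero_iff _).mpr hw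
  obtain ⟨q, hq⟩ := hsq
  have hT0 : (∏ i ∈ T, algebraMap (𝓞 K) K (Wu i : 𝓞 K)) ≠ 0 :=
    Finset.prod_ne_zero_iff.mpr fun i _ => RingOfIntegers.coe_ne_zero_iff.mpr (Units.ne_zero (Wu i))
  have hU0 : (∏ j ∈ U, algebraMap (𝓞 K) K (W j)) ≠ 0 :=
    Finset.prod_ne_zero_iff.mpr fun j _ => RingOfIntegers.coe_ne_zero_iff.mpr (hW0 j)
  have hq0 : q ≠ 0 := by
    rintro rfl
    rw [mul_zero] at hq
    exact mul_ne_zero (mul_ne_zero hξ hT0) hU0 hq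
  have key := congrArg (fun w => WithZero.log (v.valuation K w)) hq
  rw [map_mul, map_mul, WithZero.log_mul (mul_ne_zero (hne _ hξ) (hne _ hT0)) (hne _ hU0),
    WithZero.log_mul (hne _ hξ) (hne _ hT0), map_mul, WithZero.log_mul (hne _ hq0) (hne _ hq0),
    log_valuation_prod v T _ (fun i _ => RingOfIntegers.coe_ne_zero_iff.mpr (Units.ne_zero (Wu i))),
    log_valuation_prod v U _ (fun j _ => RingOfIntegers.coe_ne_zero_iff.mpr (hW0 j))] at key
  simp only [hWu, Finset.sum_const_zero, add_zero] at key
  -- `∑_{U} log v(W j)` is even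
  have heven : Even (∑ j ∈ U, WithZero.log (v.valuation K (algebraMap (𝓞 K) K (W j)))) := by
    obtain ⟨c, hc⟩ := hpar
    refine ⟨WithZero.log (v.valuation K q) - c, ?_⟩
    linarith
  rw [even_sum_iff_even_card_filter_odd] at heven
  convert heven using 2
  refine Finset.filter_congr fun j _ => ?_
  rw [hr j, ← even_iff_two_dvd, Int.not_even_iff_odd]

end Summit.BirchSwinnertonDyer.BirchSwinnertonDyer.Rank2Observatory.TwoDescCl

end
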